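import Summits.QuantumAdvantage.QuantumAdvantage.Theorems.OddPrimeWalkTypeDialA
import Summits.QuantumAdvantage.QuantumAdvantage.Theses.OddPrimeWalk
import HarnessLib

/-!
# TypeDial, part B: the NARROW piece of item 23109 `ManyReadersSqrtOdd` is a theorem

decomp-qadv lens-1 g19.  `LowCrossTalk` / `HighCrossTalk` = item 23109 VERBATIM with the extra hypothesis `NarrowCrossTalk` /
`¬ NarrowCrossTalk` (two-way low-degree cross sketches of width `k`, `k²(log₂ n)^(2C+2) ≤ n`, at some balanced separator);
`closes : LowCrossTalk → HighCrossTalk → ManyReadersSqrtOdd` (exact case split), `lowCrossTalk_holds` (from part A's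
`crossSketchLaw`), hence `target_of_high : HighCrossTalk → ManyReadersSqrtOdd`.  Support toward item 23109.
-/

set_option linter.unusedVariables false
set_option linter.unusedSectionVars false
set_option linter.dupNamespace false

noncomputable section

namespace Summit.QuantumAdvantage.QuantumAdvantage.Theorems.TypeDial

open Finset Classical
open Summit.QuantumAdvantage.AdviceFreeQNC0
open Summit.QuantumAdvantage.AdviceFreeQNC0.OddConfig
open Literature.Computability.MetaComplexity

/-! ## §0 The two pieces of item 23109 -/

/-- **Piece LOW** `LowCrossTalk` — item 23109 `ManyReadersSqrtOdd` VERBATIM with the extra hypothesis `NarrowCrossTalk`.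
Tags: crux-of-record · WEAKER (T restricted to a class) · DECIDED (`lowCrossTalk_holds`). -/
def LowCrossTalk : Prop :=
  ∀ (p : ℕ) [Fact p.Prime], 5 ≤ p → ∃ θ : ℝ, θ < 1 ∧ ∀ C : ℕ, ∃ n₀ : ℕ, ∀ n ≥ n₀, ∀ c : ℕ,
    ∀ y : Fin (n + 1) → (Fin n → Bool) → Bool, (∀ g, AdviceFreeQNC0.HasDegF p (y g) ((Nat.log 2 n) ^ C)) →
    ¬ ((Finset.univ.sup fun u : Fin n → Bool => (Finset.univ.filter fun g : Fin (n + 1) => y g u = true).card) ^ 2 *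
        (Nat.log 2 n) ^ (2 * C + 3) ≤ n) →
    (∀ w a : ℕ, ∀ S : Finset (Fin (n + 1)), w ≤ (Nat.log 2 n) ^ C → a + 2 ≤ n → S.card ≤ (Nat.log 2 n) ^ C →
      ∃ g : Fin (n + 1), g ∉ S ∧ (g.val + w < a ∨ a + 2 + w < g.val) ∧ ∃ u v : Fin n → Bool,
        (∀ i : Fin n, i.val ≠ a → i.val ≠ a + 1 → u i = v i) ∧ y g u ≠ y g v) →
    NarrowCrossTalk p n C y →
    ((Finset.univ.filter fun u : Fin n → Bool => AdviceFreeQNC0.ringWinU c y u = true).card : ℝ) ≤ θ * (2 : ℝ) ^ n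

/-- **Piece HIGH** `HighCrossTalk` — item 23109 VERBATIM with the extra hypothesis `¬ NarrowCrossTalk` (two-way WIDE
low-degree cross-talk at EVERY balanced separator).  Tags: residual · WEAKER · IDEA-NEEDED · INHABITED (NODE-g19.md §3). -/
def HighCrossTalk : Prop :=
  ∀ (p : ℕ) [Fact p.Prime], 5 ≤ p → ∃ θ : ℝ, θ < 1 ∧ ∀ C : ℕ, ∃ n₀ : ℕ, ∀ n ≥ n₀, ∀ c : ℕ,
    ∀ y : Fin (n + 1) → (Fin n → Bool) → Bool, (∀ g, AdviceFreeQNC0.HasDegF p (y g) ((Nat.log 2 n) ^ C)) →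
    ¬ ((Finset.univ.sup fun u : Fin n → Bool => (Finset.univ.filter fun g : Fin (n + 1) => y g u = true).card) ^ 2 *
        (Nat.log 2 n) ^ (2 * C + 3) ≤ n) →
    (∀ w a : ℕ, ∀ S : Finset (Fin (n + 1)), w ≤ (Nat.log 2 n) ^ C → a + 2 ≤ n → S.card ≤ (Nat.log 2 n) ^ C →
      ∃ g : Fin (n + 1), g ∉ S ∧ (g.val + w < a ∨ a + 2 + w < g.val) ∧ ∃ u v : Fin n → Bool,
        (∀ i : Fin n, i.val ≠ a → i.val ≠ a + 1 → u i = v i) ∧ y g u ≠ y g v) →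
    ¬ NarrowCrossTalk p n C y →
    ((Finset.univ.filter fun u : Fin n → Bool => AdviceFreeQNC0.ringWinU c y u = true).card : ℝ) ≤ θ * (2 : ℝ) ^ n

/-! ## §1 Assembly: the exact case split -/

/-- **`closes`** — the two pieces decide item 23109 BY NAME. -/
theorem closes (hL : LowCrossTalk) (hH : HighCrossTalk) : Theses.OddPrimeWalk.ManyReadersSqrtOdd := by
  intro p _ hp
  obtain ⟨θ₁, hθ₁, H₁⟩ := hL p hp
  obtain ⟨θ₂, hθ₂, H₂⟩ := hH p hp
  refine ⟨max θ₁ θ₂, max_lt hθ₁ hθ₂, fun C => ?_⟩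
  obtain ⟨n₁, hn₁⟩ := H₁ C
  obtain ⟨n₂, hn₂⟩ := H₂ C
  refine ⟨max n₁ n₂, fun n hn c y hdeg hbud hwin => ?_⟩
  have h2 : (0 : ℝ) ≤ (2 : ℝ) ^ n := by positivity
  by_cases hN : NarrowCrossTalk p n C y
  · exact le_trans (hn₁ n (le_trans (le_max_left _ _) hn) c y hdeg hbud hwin hN)
      (mul_le_mul_of_nonneg_right (le_max_left _ _) h2)
  · exact le_trans (hn₂ n (le_trans (le_max_right _ _) hn) c y hdeg hbud hwin hN)
      (mul_le_mul_of_nonneg_right (le_max_right _ _) h2)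

/-- **Exactness**: the target gives both pieces back (each piece is `T` restricted to a class, hence WEAKER). -/
theorem split_of_target (hT : Theses.OddPrimeWalk.ManyReadersSqrtOdd) : LowCrossTalk ∧ HighCrossTalk := by
  refine ⟨fun p _ hp => ?_, fun p _ hp => ?_⟩
  · obtain ⟨θ, hθ, H⟩ := hT p hp
    refine ⟨θ, hθ, fun C => ?_⟩
    obtain ⟨n₀, h⟩ := H C
    exact ⟨n₀, fun n hn c y hdeg hbud hwin _ => h n hn c y hdeg hbud hwin⟩
  · obtain ⟨θ, hθ, H⟩ := hT p hp
    refine ⟨θ, hθ, fun C => ?_⟩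
    obtain ⟨n₀, h⟩ := H C
    exact ⟨n₀, fun n hn c y hdeg hbud hwin _ => h n hn c y hdeg hbud hwin⟩

/-! ## §6 The LOW piece is DECIDED -/

/-- budget arithmetic: `k² (log₂ n)^(2C+2) ≤ n`, `√n ≤ 2√x` and `log₂ n ≥ 2/c₀` give `k·(log₂ n)^C ≤ c₀ √x`. -/
theorem sketch_budget {c₀ : ℝ} (hc₀ : 0 < c₀) {n k C : ℕ} (hk : k ^ 2 * Nat.log 2 n ^ (2 * C + 2) ≤ n)
    (hlogc : 2 / c₀ ≤ (Nat.log 2 n : ℝ)) {x : ℝ} (hx0 : 0 ≤ x) (hx : Real.sqrt n ≤ 2 * Real.sqrt x) :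
    ((k * Nat.log 2 n ^ C : ℕ) : ℝ) ≤ c₀ * Real.sqrt x := by
  have hK0 : (0 : ℝ) ≤ (k : ℝ) * (Nat.log 2 n : ℝ) ^ C := by positivity
  have hsq : (((k : ℝ) * (Nat.log 2 n : ℝ) ^ C) * (Nat.log 2 n : ℝ)) ^ 2 ≤ (n : ℝ) := by
    have h : ((k ^ 2 * Nat.log 2 n ^ (2 * C + 2) : ℕ) : ℝ) ≤ (n : ℝ) := by exact_mod_cast hk
    calc (((k : ℝ) * (Nat.log 2 n : ℝ) ^ C) * (Nat.log 2 n : ℝ)) ^ 2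
        = ((k ^ 2 * Nat.log 2 n ^ (2 * C + 2) : ℕ) : ℝ) := by push_cast; ring
      _ ≤ n := h
  have hKL : ((k : ℝ) * (Nat.log 2 n : ℝ) ^ C) * (Nat.log 2 n : ℝ) ≤ Real.sqrt n := by
    calc ((k : ℝ) * (Nat.log 2 n : ℝ) ^ C) * (Nat.log 2 n : ℝ)
        = Real.sqrt ((((k : ℝ) * (Nat.log 2 n : ℝ) ^ C) * (Nat.log 2 n : ℝ)) ^ 2) := by
          rw [Real.sqrt_sq (by positivity)]
      _ ≤ Real.sqrt n := Real.sqrt_le_sqrt hsq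
  have h1 : ((k : ℝ) * (Nat.log 2 n : ℝ) ^ C) * (2 / c₀) ≤ 2 * Real.sqrt x :=
    le_trans (mul_le_mul_of_nonneg_left hlogc hK0) (le_trans hKL hx)
  have h2 : ((k : ℝ) * (Nat.log 2 n : ℝ) ^ C) * 2 / c₀ ≤ 2 * Real.sqrt x := by rwa [← mul_div_assoc] at h1
  have h3 := (div_le_iff₀ hc₀).mp h2
  have e : ((k * Nat.log 2 n ^ C : ℕ) : ℝ) = (k : ℝ) * (Nat.log 2 n : ℝ) ^ C := by push_cast; ring
  rw [e]
  nlinarith [Real.sqrt_nonneg x]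

/-- **`lowCrossTalk_holds`** — the LOW piece of the TypeDial is a THEOREM (from `crossSketchLaw`; `p ≥ 5 ⇒ p ≠ 3`). -/
theorem lowCrossTalk_holds : LowCrossTalk := by
  intro p _ hp
  have hp3 : p ≠ 3 := by omega
  obtain ⟨η, hη, c₀, hc₀, m₀, H⟩ := crossSketchLaw p hp3
  refine ⟨1 - η, by linarith, fun C => ?_⟩
  obtain ⟨T, hT⟩ : ∃ T : ℕ, 2 / c₀ ≤ (T : ℝ) := ⟨⌈2 / c₀⌉₊, Nat.le_ceil _⟩
  refine ⟨max (4 * m₀ + 4) (2 ^ (max T 1)), fun n hn c y hdeg hbud hwin hN => ?_⟩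
  obtain ⟨m, k, h4m, h3n, hk, hNA⟩ := hN
  have hn1 : 4 * m₀ + 4 ≤ n := le_trans (le_max_left _ _) hn
  have hn2 : 2 ^ (max T 1) ≤ n := le_trans (le_max_right _ _) hn
  have hmn : m ≤ n := by omega
  have hm₀ : m₀ ≤ m := by omega
  have hnm₀ : m₀ ≤ n - m := by omega
  have hlogT : max T 1 ≤ Nat.log 2 n := Nat.le_log_of_pow_le (by norm_num) hn2
  have hlogc : 2 / c₀ ≤ (Nat.log 2 n : ℝ) :=
    le_trans hT (by exact_mod_cast le_trans (le_max_left T 1) hlogT)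
  have hsqm : Real.sqrt n ≤ 2 * Real.sqrt m := by
    have h : (n : ℝ) ≤ 4 * m := by exact_mod_cast h4m
    calc Real.sqrt n ≤ Real.sqrt (4 * m) := Real.sqrt_le_sqrt h
      _ = Real.sqrt 4 * Real.sqrt m := Real.sqrt_mul (by norm_num) _
      _ = 2 * Real.sqrt m := by rw [show (4 : ℝ) = 2 ^ 2 by norm_num, Real.sqrt_sq (by norm_num)]
  have hsqnm : Real.sqrt n ≤ 2 * Real.sqrt (n - m : ℕ) := by
    have h : (n : ℝ) ≤ 4 * ((n - m : ℕ) : ℝ) := by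
      rw [Nat.cast_sub hmn]
      have h3 : (4 * m : ℝ) ≤ 3 * n := by exact_mod_cast h3n
      linarith
    calc Real.sqrt n ≤ Real.sqrt (4 * ((n - m : ℕ) : ℝ)) := Real.sqrt_le_sqrt h
      _ = Real.sqrt 4 * Real.sqrt (n - m : ℕ) := Real.sqrt_mul (by norm_num) _
      _ = 2 * Real.sqrt (n - m : ℕ) := by rw [show (4 : ℝ) = 2 ^ 2 by norm_num, Real.sqrt_sq (by norm_num)]
  have hA' := sketch_budget hc₀ hk hlogc (Nat.cast_nonneg m) hsqm
  have hB' := sketch_budget hc₀ hk hlogc (Nat.cast_nonneg (n - m)) hsqnm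
  have hlose := H n m c k (Nat.log 2 n ^ C) y hm₀ hnm₀ hmn hA' hB' hNA
  have htot := card_win_add_card_lose c y
  linarith

/-- **Corollary**: item 23109 follows from the HIGH piece alone (the LOW piece being decided). -/
theorem target_of_high (hH : HighCrossTalk) : Theses.OddPrimeWalk.ManyReadersSqrtOdd := closes lowCrossTalk_holds hH


end Summit.QuantumAdvantage.QuantumAdvantage.Theorems.TypeDial
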